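import Mathlib
import Summits.Ventures.Crystal3D.Theorems.StickyWulffConstantTextureLiminfTexShadowDefs
import Literature.Analysis.Convexity.AnisotropicPerimeterPolytopePrism
import Literature.Analysis.Convexity.AnisotropicPerimeterPolytopeUnion
import HarnessLib

/-!
# Line `TexShadow` (crux `TextureLiminf`, stmt-Ventures-19483): the registered stub `stub_polytopeCalculus`

HONEST FRAMING. Part of the venture `Summits/Ventures/Crystal3D` (cell `crystal3d-full`), route
`route-Ventures-StickyWulffConstant`, crux `TextureLiminf` (stmt-Ventures-19483), line `TexShadow`
(planner cf-p1 gen 16, skeleton v4 registered).  This file proves the registered stub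
`stub_polytopeCalculus : PolytopeCalculus` BY NAME, over the verbatim definitions of
`Theorems/StickyWulffConstantTextureLiminfTexShadowDefs.lean`:  for every compact convex `K ∋ 0`,
(A) the route's distributional anisotropic perimeter of a bounded open `H`-polytope with unit outer
normals and pairwise distinct facet planes is the facet sum `Σ_facets h_K(ν_F)·facetArea(F)`
(`Literature.Analysis.Convexity.toReal_anisotropicPerimeter_iInter_halfSpace_lt_eq_facetSum`,
crystal3d-full lit g8, on eng g5's Gauss–Green for polytopes), and (B) for finitely many pairwise
disjoint bounded open polytopes with separating unit normals,
`Per_K(⋃ Q_i) = Σ Per_K(Q_i) − Σ_{i<j} (h_K(ν_ij) + h_K(−ν_ij))·facetArea(Q̄_i ∩ Q̄_j)`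
(`Literature.Analysis.Convexity.toReal_anisotropicPerimeter_iUnion_openHPolytope`, eng g7: abstract
patch theorem for the De Giorgi sup + cancellation of internal facets).  Pure continuum (Maggi 2012
§20.1); shared with the `P` line's `stub_polyhedral`.
Also the two-cell instance `per_union_two_polytopes` in the route's vocabulary (wall / interface cells).
WHAT THIS IS NOT: any of the atomistic stubs of `TexShadow` (`stub_resolution`, `stub_barlowAdhesion`,
`stub_barlowWall`, `stub_cellAccounting`); rung F-C1 not moved.
-/

noncomputable section

open scoped BigOperators InnerProductSpace ENNReal
open MeasureTheory

namespace Summit.Ventures.Crystal3D.Cruxes.TextureLiminf.TexShadow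

open Literature.Analysis.Convexity

/-- **stub (facet calculus)** — `PolytopeCalculus` holds: (A) facet formula for one bounded open convex
polytope (unit outer normals, pairwise distinct facet planes); (B) finite disjoint unions with separating
unit normals: the common facets cancel with both orientations.  `facetArea` is the unit-prism volume
(= the area of a planar piece with unit normal). -/
theorem stub_polytopeCalculus : PolytopeCalculus := by
  intro K hKc hK hK0
  refine ⟨fun H hbd h1 hd => ?_, fun k H ν hbd hdisj hν => ?_⟩
  · simp only [per, perK_eq_anisotropicPerimeter, supportFn, facetArea]
    exact toReal_anisotropicPerimeter_iInter_halfSpace_lt_eq_facetSum H hbd h1 hd hKc hK hK0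
  · simp only [per, perK_eq_anisotropicPerimeter, supportFn, facetArea]
    exact toReal_anisotropicPerimeter_iUnion_openHPolytope H (fun i => polytope (H i)) (fun i => rfl) ν
      hbd hdisj hν hKc hK hK0

/-- **Two cells** (the `k = 2` instance of clause (B), in the route's vocabulary): for two disjoint
bounded open polytopes whose closures meet inside a plane `⟪ν, x⟫ = b` (`‖ν‖ = 1`),
`per K (Q₁ ∪ Q₂) = per K Q₁ + per K Q₂ − (h_K(ν) + h_K(−ν)) · facetArea (closure Q₁ ∩ closure Q₂) ν`;
equivalently the route's interface term `ι_K(Q₁, Q₂) = ½ (h_K(ν) + h_K(−ν)) · facetArea`.  This is the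
form in which wall / coherent-interface cells enter `stub_cellAccounting` and `stub_polyhedral`. -/
theorem per_union_two_polytopes (K : Set E3) (hKc : IsCompact K) (hK : Convex ℝ K) (hK0 : (0 : E3) ∈ K)
    (H₁ H₂ : Finset (E3 × ℝ)) (hbd₁ : Bornology.IsBounded (polytope H₁))
    (hbd₂ : Bornology.IsBounded (polytope H₂)) (hdisj : Disjoint (polytope H₁) (polytope H₂))
    (ν : E3) (hν : ‖ν‖ = 1) (b : ℝ)
    (hR : closure (polytope H₁) ∩ closure (polytope H₂) ⊆ {x | ⟪ν, x⟫_ℝ = b}) :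
    per K (polytope H₁ ∪ polytope H₂) = per K (polytope H₁) + per K (polytope H₂) -
      (supportFn K ν + supportFn K (-ν)) * facetArea (closure (polytope H₁) ∩ closure (polytope H₂)) ν := by
  classical
  set Q : Fin 2 → Set E3 := ![polytope H₁, polytope H₂] with hQdef
  have hQ : ∀ i, Q i = ⋂ p ∈ (![H₁, H₂] : Fin 2 → Finset (E3 × ℝ)) i, {x : E3 | ⟪p.1, x⟫_ℝ < p.2} := by
    intro i; fin_cases i <;> rfl
  have hbd : ∀ i, Bornology.IsBounded (Q i) := by
    intro i; fin_cases i
    · exact hbd₁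
    · exact hbd₂
  have hdisj' : ∀ i j, i ≠ j → Disjoint (Q i) (Q j) := by
    intro i j hij
    fin_cases i <;> fin_cases j
    · exact absurd rfl hij
    · exact hdisj
    · exact hdisj.symm
    · exact absurd rfl hij
  have hν' : ∀ i j : Fin 2, i ≠ j → ‖(fun _ _ : Fin 2 => ν) i j‖ = 1 ∧ ∃ β : ℝ,
      closure (Q i) ∩ closure (Q j) ⊆ {x : E3 | ⟪(fun _ _ : Fin 2 => ν) i j, x⟫_ℝ = β} := by
    intro i j hij
    refine ⟨hν, b, ?_⟩
    fin_cases i <;> fin_cases j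
    · exact absurd rfl hij
    · exact hR
    · show closure (polytope H₂) ∩ closure (polytope H₁) ⊆ _
      rw [Set.inter_comm]; exact hR
    · exact absurd rfl hij
  have hB := toReal_anisotropicPerimeter_iUnion_openHPolytope ![H₁, H₂] Q hQ (fun _ _ => ν) hbd hdisj' hν'
    hKc hK hK0
  have hU : (⋃ i, Q i) = polytope H₁ ∪ polytope H₂ := by
    ext x
    simp only [Set.mem_iUnion, Set.mem_union, Fin.exists_fin_two]
    rfl
  simp only [per, perK_eq_anisotropicPerimeter, supportFn, facetArea]
  rw [← hU, hB, Fin.sum_univ_two, Fin.sum_univ_two, Fin.sum_univ_two, Fin.sum_univ_two]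
  simp only [show ¬ ((0 : Fin 2) < 0) from lt_irrefl _, show (0 : Fin 2) < 1 from by decide,
    show ¬ ((1 : Fin 2) < 0) from by decide, show ¬ ((1 : Fin 2) < 1) from lt_irrefl _, if_true, if_false,
    add_zero, zero_add]
  rfl


end Summit.Ventures.Crystal3D.Cruxes.TextureLiminf.TexShadow

end
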